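import Summits.QuantumFields.BalabanUV.T4Continuum.Spine.NE1p.DressedRebornMuPartSlotLetters
import Summits.QuantumFields.BalabanUV.T4Continuum.Spine.NE1p.DressedRebornMuResponseSlotLetters
import Summits.QuantumFields.BalabanUV.T4Continuum.Spine.NE1p.DressedSmallFieldGeometryFaces

/-!
# T⁴ programme, spine estimate NE1′ (node O3b/H2) — THE RE-BORN μ-PART AND ITS LINEAR RESPONSE AT THE SUBSTRATE'S SLOT LETTERS, ON THE
# TORUS: S63 §1∕§2 (`rebornMuPart_locE_le_of_actOfLetters` ∕ `_of_coreLettersOf`) and S69 §1∕§2 (`rebornMuDeriv_locE_le_of_actOfLetters` ∕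
# `_of_coreLettersOf`) at pv22's `tgeometry 4 N` — NO geometry hypothesis, located numerals `(ν, c₁, K₀) = (9, 64, K₀(64,8))`,
# `κ₀ = 64·log 162`, `d = torusTreeLen`; S52-B §3∕§4's and S58's torus-column pattern VERBATIM for the DRESSED (bilinear) regeneration
# END and its response at the letters

Cell `pub-balaban`, sub-cell `t4`, BINDER-OWNERS row NE1′; NE1′ formalisation crew, unit `b2b-balaban-t4-ne1p-formalise-leaf-03`
(LEAF PROVER 03, generation 15); crew row S70 ∕ DAG N29zzzzzzf of `t4/formal/NE1p/LEAVES.md`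
(BOOKED typer R-T157; read X263 ok) (own-lineage torus column of S63
`DressedRebornMuPartSlotLetters` (p243664) and S69 `DressedRebornMuResponseSlotLetters` (p245765), exactly as S64 is S56∕S61's at the cores
and S52-B §3∕§4 are S52-A §2∕§3's).  ADDITIVE — imports S63 + S69 (→ S56 ∕ S61 → S33; → S30-letters → the substrate) + S24
`Spine/NE1p/DressedSmallFieldGeometryFaces` (pv22's `tgeometry`, `torus_consts`, `K₀_four`) ONLY; THEOREMS ONLY (4 thm, 0 def, 0
`def … : Prop`, 0 cite); nothing restated.

WHY THIS FILE.  The letters faces of the re-born μ-part (S63) and of its response (S69) carry an abstract `Geometry D Cube`; every other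
letters END of the column has its torus form of record (S52-B §3∕§4 `regenPart_locE_le_of_actOfLetters_torus` ∕ `_coreLettersOf_torus`;
S58 §3∕§4; `DressedSmallFieldOnCoresSlotLettersTorus`; `DressedSourceAnalyticSlotLettersTorus`).  Here, the same substitution («module §k ↦
S63 ∕ S69 §k, `b₅ := 5·r₁`, `rw [hν, hc, hK₀] at h; exact h`»):
* §1 `rebornMuPart_locE_le_of_actOfLetters_torus` (S63 §1 ONCE) and §2 `rebornMuDeriv_locE_le_of_actOfLetters_torus` (S69 §1 ONCE) — at
  the substrate's slot activities `Σ actOfLetters ℓ … o (h₀ + m • u + s • v)`;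
* §3 `rebornMuPart_locE_le_of_coreLettersOf_torus` (S63 §2 ONCE) and §4 `rebornMuDeriv_locE_le_of_coreLettersOf_torus` (S69 §2 ONCE) — at
  the Gaussian letters of record `coreLettersOf A`, operator letters discharged (S30 §1 inside S63∕S69).
Bounds: `2·((2·(e·9·64·K₀(64,8)²·A·e^{−r₁·torusTreeLen X₀}))∕μ₁·‖μ‖)∕ε·‖v‖` (size) and `2·((2·M∕ε)·‖v‖)∕(μ₁ − μ₀)` (response).  ALL
conclusions pin `locE (Dom := (tsys 4 N).Dom) (TTouch …) (fun Z => Z.1)` (S31 ∕ S50-A ∕ S52-B's elaboration note).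

WHAT STAYS DISPLAYED (binders, by name; NOTHING instantiated on Bałaban's densities): as in S63∕S69 minus the geometry — the letters `ℓ`
resp. the substrate's primitive letter conditions `hbase` ∕ `hrdm` ∕ `hβ₀` ∕ `hd₀` ∕ `hrd` ∕ `hctr` ∕ `hbud` ∕ `hmq`; `hroom`; `hO`∕`hH`
(room for BOTH directions); (B1b)'s residue `terms`∕`emb`∕`hscale`; the torus clause numerals `r₁ + 2·(64·log 162) + 2 ≤ R`,
`A·e^{5r₁+1}·K₀(64,8)·9·64 ≤ 1`; (B3) = `hM3` (G-ne9p2-5, UNPRINTED, shared with NE9, a BINDER); the source radius ∕ window, the content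
direction `v` with `0 < ‖v‖ < ε`.  The located constants are READINGS of the dressed (w5) constant and of its response at pv22's torus
geometry ((B4) BY NAME, pv22's READING D-pv22.3) — (B1a) discharged at the letters, (w5)∕(w6) NOT discharged on Bałaban's densities.

HONEST FRAMING.  By-name specialisation over SHAPES at pv22's CONSTRUCTED torus geometry; (B1a) relocated onto row NE5's exp-linear
FORMAT hypothesis — identification with Bałaban's (2.14) = the substrate's DISPLAYED reading, NOT claimed; (B1b) ∕ (B3) ∕ (B5) NOT
discharged; 0 binders instantiated on Bałaban's densities; no new inequality; no wall item of NE1′ or NE5 moves; the NE1′ wall wording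
of record v1.8 (T4-DAG v48) — words, not kind — does NOT move; R-t4r2-Q2 NOT met; ABSOLUTE RULE honoured ([folklore] kernel lemmas
only; no numeral of print; no disputed step of the audited manuscripts enters as a fact).  NE1′ ⇐ the named binders — NOT proved, NOT
printed; spine PROVED 0∕9; count 9 unchanged.  Rung (B)+1 on ONE finite four-torus — NOT infinite volume, NOT a mass gap, NOT OS on
ℝ⁴, NOT Clay.  HONEST DEPENDENCY: continuum YM on T⁴ ⇐ BetaPertH ∧ nine spine estimates (0/9 proved); BetaPertH ⇐ (D1) ∧ (D4) ∧
CAP+tail; G-an2-4 gates asym, D1 and NE2/3/4.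
-/

noncomputable section

namespace Summit.QuantumFields.BalabanUV.T4Continuum.NE1p.DressedRebornMuPartSlotLettersTorus

open scoped BigOperators Matrix
open Metric Set MeasureTheory
open Literature.MathematicalPhysics.QuantumFieldTheory.Balaban1983to89
open Literature.MathematicalPhysics.QuantumFieldTheory.Balaban1983to89.T4OutputRate (Carriers)
open Literature.MathematicalPhysics.QuantumFieldTheory.Balaban1983to89.B13Resummation (locE)
open Literature.MathematicalPhysics.QuantumFieldTheory.Balaban1983to89.B5Prop11Lower (nsq)
open Literature.MathematicalPhysics.QuantumFieldTheory.Balaban1983to89.TreeLengthTorus (tsys torusTreeLen)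
open Literature.MathematicalPhysics.QuantumFieldTheory.Balaban1983to89.TreeLengthTorusGeometry (TTouch tgeometry)
open Literature.MathematicalPhysics.QuantumFieldTheory.Balaban1983to89.B12TreeDecay (K₀)
open Summit.QuantumFields.BalabanUV.T4Continuum.B13HistMeasurable (MeasPotFrame B13HistM)
open Summit.QuantumFields.BalabanUV.T4Continuum.SubstrateTwoRunsDriven (DrivenRuns)
open Summit.QuantumFields.BalabanUV.T4Continuum.SubstrateActivities (CoreLetters coreOf actOfLetters)
open Summit.QuantumFields.BalabanUV.T4Continuum.SubstrateGaussianLetters (gaussC linForm)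
open Summit.QuantumFields.BalabanUV.T4Continuum.SubstrateGaussianLettersBall (detBudget)
open Summit.QuantumFields.BalabanUV.T4Continuum.SubstrateSlotsOfRecord (ActLetters coreLettersOf)
open Summit.QuantumFields.BalabanUV.T4Continuum.NE1p.DressedRebornMuPartSlotLetters (rebornMuPart_locE_le_of_actOfLetters
  rebornMuPart_locE_le_of_coreLettersOf)
open Summit.QuantumFields.BalabanUV.T4Continuum.NE1p.DressedRebornMuResponseSlotLetters (rebornMuDeriv_locE_le_of_actOfLetters
  rebornMuDeriv_locE_le_of_coreLettersOf)
open Summit.QuantumFields.BalabanUV.T4Continuum.NE1p.DressedSmallFieldGeometry (torus_consts)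
open Summit.QuantumFields.BalabanUV.T4Continuum.NE1p.DressedSmallFieldGeometryFaces (K₀_four)

variable {N : ℕ} [NeZero N]

/-! ## §1–§2 AT THE SUBSTRATE'S LETTERS `actOfLetters ℓ`, ON THE TORUS -/

section Slot
variable {C : Carriers} (P : MeasPotFrame C) (Op : Type*) [NormedAddCommGroup Op] [NormedSpace ℂ Op] {Pol J : Type*}
  (𝒴 : Pol → J → Type) [∀ Z j, Fintype (𝒴 Z j)] (dom : ∀ Z j, 𝒴 Z j → C.Dom)
  (Jc : Pol → J → Type) [∀ Z j, Fintype (Jc Z j)]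
  (V : Pol → J → Type) [∀ Z j, NormedAddCommGroup (V Z j)] [∀ Z j, InnerProductSpace ℝ (V Z j)]
  [∀ Z j, MeasurableSpace (V Z j)] [∀ Z j, BorelSpace (V Z j)] [∀ Z j, FiniteDimensional ℝ (V Z j)]

open Classical in
/-- **THE RE-BORN μ-PART OF THE DRESSED OUTPUT OF THE SLOT ACTIVITIES, ON THE TORUS — NO GEOMETRY HYPOTHESIS** (kernel; S63 §1
`rebornMuPart_locE_le_of_actOfLetters` ONCE BY NAME at `tsys 4 N` ∕ `tgeometry 4 N`, `b₅ := 5·r₁`, constants located by `torus_consts` ∕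
`K₀_four`). [folklore] -/
theorem rebornMuPart_locE_le_of_actOfLetters_torus {W : Set (ℕ → ℝ)} {ctr : ℕ → (ℕ → ℝ) → C.BgB → Op × B13HistM P}
    {ROp RHist R' : ℕ → ℝ} (ℓ : ∀ Z j, CoreLetters P Op 𝒴 dom Jc V Z j) {mq bq N₀ : ℕ → Pol × J → C.Dom → ℝ}
    (hroom : ∀ k, ROp k < R' k) (hm : ∀ k, ∀ g ∈ W, ∀ (U : C.BgB) (X : C.Dom), C.scale X = k → ∀ p, 0 < mq k p X)
    (hN : ∀ k, ∀ g ∈ W, ∀ (U : C.BgB) (X : C.Dom), C.scale X = k → ∀ p : Pol × J,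
      (∀ o ∈ ball (ctr k g U).1 (R' k),
        AEStronglyMeasurable ((ℓ p.1 p.2).N o) (coreOf P Op 𝒴 dom Jc V ℓ p.1 p.2).lam) ∧
      (∀ a, DifferentiableOn ℂ (fun o => (ℓ p.1 p.2).N o a) (ball (ctr k g U).1 (R' k))) ∧
      (∀ o ∈ ball (ctr k g U).1 (R' k), ∀ a, ‖(ℓ p.1 p.2).N o a‖ ≤ N₀ k p X))
    (hq : ∀ k, ∀ g ∈ W, ∀ (U : C.BgB) (X : C.Dom), C.scale X = k → ∀ p : Pol × J,
      (∀ o ∈ ball (ctr k g U).1 (R' k),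
        AEStronglyMeasurable (Function.uncurry ((ℓ p.1 p.2).q o))
          ((coreOf P Op 𝒴 dom Jc V ℓ p.1 p.2).lam.prod volume)) ∧
      (∀ a v, DifferentiableOn ℂ (fun o => (ℓ p.1 p.2).q o a v) (ball (ctr k g U).1 (R' k))) ∧
      (∀ o ∈ ball (ctr k g U).1 (R' k), ∀ a v, mq k p X * ‖v‖ ^ 2 - bq k p X ≤ ((ℓ p.1 p.2).q o a v).re))
    {k : ℕ} {g : ℕ → ℝ} (hg : g ∈ W) {U : C.BgB} {o : Op} {h₀ u v : B13HistM P} {μ₁ ε : ℝ}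
    (hv : 0 < ‖v‖) (hvε : ‖v‖ < ε)
    (hO : ‖o - (ctr k g U).1‖ ≤ ROp k) (hH : ‖h₀ - (ctr k g U).2‖ + μ₁ * ‖u‖ + ε ≤ RHist k)
    {emb : (tsys 4 N).Dom → C.Dom} (hscale : ∀ Z, C.scale (emb Z) = k) (terms : (tsys 4 N).Dom → Finset (Pol × J))
    {A R r₁ : ℝ} (X₀ : (tsys 4 N).Dom) (hA : 0 ≤ A) (hr₁ : 0 ≤ r₁)
    (hrate : r₁ + 2 * (64 * Real.log 162) + 2 ≤ R) (hsmall : A * Real.exp (5 * r₁ + 1) * K₀ 64 8 * 9 * 64 ≤ 1) (hM3 : ∀ Z : (tsys 4 N).Dom, Z.1 ⊆ X₀.1 →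
      ∑ p ∈ terms Z, (coreOf P Op 𝒴 dom Jc V ℓ p.1 p.2).lam.real univ *
          ((coreOf P Op 𝒴 dom Jc V ℓ p.1 p.2).wB * N₀ k p (emb Z) * Real.exp (bq k p (emb Z))) *
          (Real.pi / (mq k p (emb Z) / 2)) ^ (Module.finrank ℝ (V p.1 p.2) / 2 : ℝ) *
        Real.exp ((coreOf P Op 𝒴 dom Jc V ℓ p.1 p.2).N₁ * (‖h₀‖ + μ₁ * ‖u‖ + ε)) ≤ A * Real.exp (-(R * torusTreeLen Z.1)))
    {μ : ℂ} (hμ : μ ∈ ball (0 : ℂ) μ₁) :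
    ‖locE (Dom := (tsys 4 N).Dom) (TTouch (d := 4) (N := N)) (fun Z : (tsys 4 N).Dom => Z.1) (fun Z => ∑ p ∈ terms Z, actOfLetters P Op 𝒴 dom Jc V ℓ p.1 p.2 o (h₀ + μ • u + (1 : ℂ) • v)) X₀.1 -
        locE (Dom := (tsys 4 N).Dom) (TTouch (d := 4) (N := N)) (fun Z : (tsys 4 N).Dom => Z.1) (fun Z => ∑ p ∈ terms Z, actOfLetters P Op 𝒴 dom Jc V ℓ p.1 p.2 o (h₀ + (0 : ℂ) • u + (1 : ℂ) • v))
          X₀.1 -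
        (locE (Dom := (tsys 4 N).Dom) (TTouch (d := 4) (N := N)) (fun Z : (tsys 4 N).Dom => Z.1) (fun Z => ∑ p ∈ terms Z, actOfLetters P Op 𝒴 dom Jc V ℓ p.1 p.2 o (h₀ + μ • u + (0 : ℂ) • v))
            X₀.1 -
          locE (Dom := (tsys 4 N).Dom) (TTouch (d := 4) (N := N)) (fun Z : (tsys 4 N).Dom => Z.1) (fun Z => ∑ p ∈ terms Z, actOfLetters P Op 𝒴 dom Jc V ℓ p.1 p.2 o (h₀ + (0 : ℂ) • u + (0 : ℂ) • v))
            X₀.1)‖ ≤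
      2 * (2 * (Real.exp 1 * 9 * 64 * K₀ 64 8 ^ 2 * A * Real.exp (-(r₁ * torusTreeLen X₀.1))) / μ₁ * ‖μ‖) / ε * ‖v‖ := by
  obtain ⟨hν, hκ, hc⟩ := torus_consts N
  have hK₀ := K₀_four (N := N)
  have h := rebornMuPart_locE_le_of_actOfLetters P Op 𝒴 dom Jc V (tsys 4 N) (tgeometry 4 N) ℓ hroom hm hN hq hg hv hvε hO hH hscale terms
    (R := R) (b₅ := 5 * r₁) (X₀ := X₀) hA hr₁ (le_of_eq (by ring)) (by rw [hκ]; exact hrate)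
    (by rw [hK₀, hν, hc]; exact hsmall) hM3 hμ
  rw [hν, hc, hK₀] at h
  exact h

open Classical in
/-- **THE RESPONSE OF THE RE-BORN PART OF THE DRESSED OUTPUT OF THE SLOT ACTIVITIES, ON THE TORUS — NO GEOMETRY HYPOTHESIS** (kernel;
S69 §1 `rebornMuDeriv_locE_le_of_actOfLetters` ONCE BY NAME at `tsys 4 N` ∕ `tgeometry 4 N`, `b₅ := 5·r₁`, `torus_consts` ∕ `K₀_four`). [folklore] -/
theorem rebornMuDeriv_locE_le_of_actOfLetters_torus {W : Set (ℕ → ℝ)} {ctr : ℕ → (ℕ → ℝ) → C.BgB → Op × B13HistM P}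
    {ROp RHist R' : ℕ → ℝ} (ℓ : ∀ Z j, CoreLetters P Op 𝒴 dom Jc V Z j) {mq bq N₀ : ℕ → Pol × J → C.Dom → ℝ}
    (hroom : ∀ k, ROp k < R' k) (hm : ∀ k, ∀ g ∈ W, ∀ (U : C.BgB) (X : C.Dom), C.scale X = k → ∀ p, 0 < mq k p X)
    (hN : ∀ k, ∀ g ∈ W, ∀ (U : C.BgB) (X : C.Dom), C.scale X = k → ∀ p : Pol × J,
      (∀ o ∈ ball (ctr k g U).1 (R' k),
        AEStronglyMeasurable ((ℓ p.1 p.2).N o) (coreOf P Op 𝒴 dom Jc V ℓ p.1 p.2).lam) ∧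
      (∀ a, DifferentiableOn ℂ (fun o => (ℓ p.1 p.2).N o a) (ball (ctr k g U).1 (R' k))) ∧
      (∀ o ∈ ball (ctr k g U).1 (R' k), ∀ a, ‖(ℓ p.1 p.2).N o a‖ ≤ N₀ k p X))
    (hq : ∀ k, ∀ g ∈ W, ∀ (U : C.BgB) (X : C.Dom), C.scale X = k → ∀ p : Pol × J,
      (∀ o ∈ ball (ctr k g U).1 (R' k),
        AEStronglyMeasurable (Function.uncurry ((ℓ p.1 p.2).q o))
          ((coreOf P Op 𝒴 dom Jc V ℓ p.1 p.2).lam.prod volume)) ∧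
      (∀ a v, DifferentiableOn ℂ (fun o => (ℓ p.1 p.2).q o a v) (ball (ctr k g U).1 (R' k))) ∧
      (∀ o ∈ ball (ctr k g U).1 (R' k), ∀ a v, mq k p X * ‖v‖ ^ 2 - bq k p X ≤ ((ℓ p.1 p.2).q o a v).re))
    {k : ℕ} {g : ℕ → ℝ} (hg : g ∈ W) {U : C.BgB} {o : Op} {h₀ u v : B13HistM P} {μ₁ ε : ℝ}
    (hv : 0 < ‖v‖) (hvε : ‖v‖ < ε)
    (hO : ‖o - (ctr k g U).1‖ ≤ ROp k) (hH : ‖h₀ - (ctr k g U).2‖ + μ₁ * ‖u‖ + ε ≤ RHist k)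
    {emb : (tsys 4 N).Dom → C.Dom} (hscale : ∀ Z, C.scale (emb Z) = k) (terms : (tsys 4 N).Dom → Finset (Pol × J))
    {A R r₁ : ℝ} (X₀ : (tsys 4 N).Dom) (hA : 0 ≤ A) (hr₁ : 0 ≤ r₁)
    (hrate : r₁ + 2 * (64 * Real.log 162) + 2 ≤ R) (hsmall : A * Real.exp (5 * r₁ + 1) * K₀ 64 8 * 9 * 64 ≤ 1) (hM3 : ∀ Z : (tsys 4 N).Dom, Z.1 ⊆ X₀.1 →
      ∑ p ∈ terms Z, (coreOf P Op 𝒴 dom Jc V ℓ p.1 p.2).lam.real univ *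
          ((coreOf P Op 𝒴 dom Jc V ℓ p.1 p.2).wB * N₀ k p (emb Z) * Real.exp (bq k p (emb Z))) *
          (Real.pi / (mq k p (emb Z) / 2)) ^ (Module.finrank ℝ (V p.1 p.2) / 2 : ℝ) *
        Real.exp ((coreOf P Op 𝒴 dom Jc V ℓ p.1 p.2).N₁ * (‖h₀‖ + μ₁ * ‖u‖ + ε)) ≤ A * Real.exp (-(R * torusTreeLen Z.1)))
    {μ₀ : ℝ} (h01 : μ₀ < μ₁) {μ : ℂ} (hμ : ‖μ‖ ≤ μ₀) :
    ‖deriv (fun m : ℂ =>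
        locE (Dom := (tsys 4 N).Dom) (TTouch (d := 4) (N := N)) (fun Z : (tsys 4 N).Dom => Z.1) (fun Z => ∑ p ∈ terms Z, actOfLetters P Op 𝒴 dom Jc V ℓ p.1 p.2 o (h₀ + m • u + (1 : ℂ) • v))
            X₀.1 -
          locE (Dom := (tsys 4 N).Dom) (TTouch (d := 4) (N := N)) (fun Z : (tsys 4 N).Dom => Z.1) (fun Z => ∑ p ∈ terms Z, actOfLetters P Op 𝒴 dom Jc V ℓ p.1 p.2 o (h₀ + m • u + (0 : ℂ) • v))
            X₀.1) μ‖ ≤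
      2 * (2 * (Real.exp 1 * 9 * 64 * K₀ 64 8 ^ 2 * A * Real.exp (-(r₁ * torusTreeLen X₀.1))) / ε * ‖v‖) / (μ₁ - μ₀) := by
  obtain ⟨hν, hκ, hc⟩ := torus_consts N
  have hK₀ := K₀_four (N := N)
  have h := rebornMuDeriv_locE_le_of_actOfLetters P Op 𝒴 dom Jc V (tsys 4 N) (tgeometry 4 N) ℓ hroom hm hN hq hg hv hvε hO hH hscale terms
    (R := R) (b₅ := 5 * r₁) (X₀ := X₀) hA hr₁ (le_of_eq (by ring)) (by rw [hκ]; exact hrate)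
    (by rw [hK₀, hν, hc]; exact hsmall) hM3 h01 hμ
  rw [hν, hc, hK₀] at h
  exact h

end Slot

/-! ## §3–§4 AT THE GAUSSIAN LETTERS OF RECORD `coreLettersOf A`, ON THE TORUS -/

section CoreLettersOf

variable {G : Type} [GaugeGroup G] (D : DrivenRuns G) (P : MeasPotFrame D.carriers)
variable (Op : Type) [NormedAddCommGroup Op] [NormedSpace ℂ Op] {J : Type}
  (𝒵 : D.carriers.Dom → J → Type) [∀ Z j, Fintype (𝒵 Z j)] (dom : ∀ Z j, 𝒵 Z j → D.carriers.Dom)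
  (Jc : D.carriers.Dom → J → Type) [∀ Z j, Fintype (Jc Z j)]
  (V : D.carriers.Dom → J → Type) [∀ Z j, NormedAddCommGroup (V Z j)] [∀ Z j, InnerProductSpace ℝ (V Z j)]
  [∀ Z j, MeasurableSpace (V Z j)] [∀ Z j, BorelSpace (V Z j)] [∀ Z j, FiniteDimensional ℝ (V Z j)]
  (mI : D.carriers.Dom → J → Type) [∀ Z j, Fintype (mI Z j)] [∀ Z j, DecidableEq (mI Z j)]

open Classical in
/-- **THE RE-BORN μ-PART AT THE CORE LETTERS OF RECORD, ON THE TORUS — NO GEOMETRY HYPOTHESIS, OPERATOR LETTERS DISCHARGED** (kernel;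
S63 §2 `rebornMuPart_locE_le_of_coreLettersOf` ONCE BY NAME at `tsys 4 N` ∕ `tgeometry 4 N`, `b₅ := 5·r₁`, `torus_consts` ∕ `K₀_four`). [folklore] -/
theorem rebornMuPart_locE_le_of_coreLettersOf_torus {W : Set (ℕ → ℝ)} {ctr : ℕ → (ℕ → ℝ) → D.carriers.BgB → Op × B13HistM P}
    {ROp RHist R' : ℕ → ℝ} (A : ∀ Z j, ActLetters D P Op 𝒵 dom Jc V mI Z j) {β₀ ϑ d₀ γ : D.carriers.Dom → J → ℝ}
    (hroom : ∀ k, ROp k < R' k) (hR' : ∀ k, 0 ≤ R' k)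
    (hbase : ∀ Z j ii jj, Measurable fun a => (A Z j).base a ii jj)
    (hrdm : ∀ Z j ii jj (o' : Op), Measurable fun a => (A Z j).rd a ii jj o')
    (hβ₀ : ∀ Z j, 0 ≤ β₀ Z j) (hd₀ : ∀ Z j, 0 < d₀ Z j)
    (hrd : ∀ Z j a ii jj, ‖(A Z j).rd a ii jj‖ ≤ ϑ Z j)
    (hctr : ∀ k, ∀ g ∈ W, ∀ (U : D.carriers.BgB) (Z : D.carriers.Dom) (j : J) (a : (Jc Z j ⊕ 𝒵 Z j) → ℝ × ℝ),
      (∀ ii jj, ‖linForm (A Z j).base (A Z j).rd (ctr k g U).1 a ii jj‖ ≤ β₀ Z j) ∧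
      ((linForm (A Z j).base (A Z j).rd (ctr k g U).1 a).det).im = 0 ∧ d₀ Z j ≤ ((linForm (A Z j).base (A Z j).rd (ctr k g U).1 a).det).re ∧
      (∀ x : mI Z j → ℂ, γ Z j * nsq x ≤ (star x ⬝ᵥ (linForm (A Z j).base (A Z j).rd (ctr k g U).1 a *ᵥ x)).re))
    (hbud : ∀ k Z j, detBudget (Fintype.card (mI Z j)) (β₀ Z j) (ϑ Z j) (R' k) < d₀ Z j)
    (hmq : ∀ k Z j, Fintype.card (mI Z j) * ϑ Z j * R' k < γ Z j)
    {k : ℕ} {g : ℕ → ℝ} (hg : g ∈ W) {U : D.carriers.BgB} {o : Op} {h₀ u v : B13HistM P} {μ₁ ε : ℝ}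
    (hv : 0 < ‖v‖) (hvε : ‖v‖ < ε)
    (hO : ‖o - (ctr k g U).1‖ ≤ ROp k) (hH : ‖h₀ - (ctr k g U).2‖ + μ₁ * ‖u‖ + ε ≤ RHist k)
    {emb : (tsys 4 N).Dom → D.carriers.Dom} (hscale : ∀ Z, D.carriers.scale (emb Z) = k)
    (terms : (tsys 4 N).Dom → Finset (D.carriers.Dom × J))
    {A' R r₁ : ℝ} (X₀ : (tsys 4 N).Dom) (hA : 0 ≤ A') (hr₁ : 0 ≤ r₁)
    (hrate : r₁ + 2 * (64 * Real.log 162) + 2 ≤ R) (hsmall : A' * Real.exp (5 * r₁ + 1) * K₀ 64 8 * 9 * 64 ≤ 1)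
    (hM3 : ∀ Z : (tsys 4 N).Dom, Z.1 ⊆ X₀.1 →
      ∑ p ∈ terms Z, (coreOf P Op 𝒵 dom Jc V (coreLettersOf D P Op 𝒵 dom Jc V mI A) p.1 p.2).lam.real univ *
          ((coreOf P Op 𝒵 dom Jc V (coreLettersOf D P Op 𝒵 dom Jc V mI A) p.1 p.2).wB *
              (gaussC (mI p.1 p.2) * Real.sqrt (max 1 ((Fintype.card (mI p.1 p.2)).factorial *
                β₀ p.1 p.2 ^ Fintype.card (mI p.1 p.2) + d₀ p.1 p.2))) * Real.exp 0) *
          (Real.pi / ((γ p.1 p.2 - Fintype.card (mI p.1 p.2) * ϑ p.1 p.2 * R' k) / 2 / 2)) ^ (Module.finrank ℝ (V p.1 p.2) / 2 : ℝ) *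
        Real.exp ((coreOf P Op 𝒵 dom Jc V (coreLettersOf D P Op 𝒵 dom Jc V mI A) p.1 p.2).N₁ * (‖h₀‖ + μ₁ * ‖u‖ + ε)) ≤
        A' * Real.exp (-(R * torusTreeLen Z.1)))
    {μ : ℂ} (hμ : μ ∈ ball (0 : ℂ) μ₁) :
    ‖locE (Dom := (tsys 4 N).Dom) (TTouch (d := 4) (N := N)) (fun Z : (tsys 4 N).Dom => Z.1) (fun Z => ∑ p ∈ terms Z,
          actOfLetters P Op 𝒵 dom Jc V (coreLettersOf D P Op 𝒵 dom Jc V mI A) p.1 p.2 o (h₀ + μ • u + (1 : ℂ) • v)) X₀.1 -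
        locE (Dom := (tsys 4 N).Dom) (TTouch (d := 4) (N := N)) (fun Z : (tsys 4 N).Dom => Z.1) (fun Z => ∑ p ∈ terms Z,
          actOfLetters P Op 𝒵 dom Jc V (coreLettersOf D P Op 𝒵 dom Jc V mI A) p.1 p.2 o (h₀ + (0 : ℂ) • u + (1 : ℂ) • v))
          X₀.1 -
        (locE (Dom := (tsys 4 N).Dom) (TTouch (d := 4) (N := N)) (fun Z : (tsys 4 N).Dom => Z.1) (fun Z => ∑ p ∈ terms Z,
            actOfLetters P Op 𝒵 dom Jc V (coreLettersOf D P Op 𝒵 dom Jc V mI A) p.1 p.2 o (h₀ + μ • u + (0 : ℂ) • v))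
            X₀.1 -
          locE (Dom := (tsys 4 N).Dom) (TTouch (d := 4) (N := N)) (fun Z : (tsys 4 N).Dom => Z.1) (fun Z => ∑ p ∈ terms Z,
            actOfLetters P Op 𝒵 dom Jc V (coreLettersOf D P Op 𝒵 dom Jc V mI A) p.1 p.2 o (h₀ + (0 : ℂ) • u + (0 : ℂ) • v))
            X₀.1)‖ ≤
      2 * (2 * (Real.exp 1 * 9 * 64 * K₀ 64 8 ^ 2 * A' * Real.exp (-(r₁ * torusTreeLen X₀.1))) / μ₁ * ‖μ‖) / ε * ‖v‖ := by
  obtain ⟨hν, hκ, hc⟩ := torus_consts N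
  have hK₀ := K₀_four (N := N)
  have h := rebornMuPart_locE_le_of_coreLettersOf D P Op 𝒵 dom Jc V mI (tsys 4 N) (tgeometry 4 N) A hroom hR' hbase hrdm hβ₀ hd₀ hrd
    hctr hbud hmq hg hv hvε hO hH hscale terms (R := R) (b₅ := 5 * r₁) (X₀ := X₀) hA hr₁ (le_of_eq (by ring))
    (by rw [hκ]; exact hrate) (by rw [hK₀, hν, hc]; exact hsmall) hM3 hμ
  rw [hν, hc, hK₀] at h
  exact h

open Classical in
/-- **THE RESPONSE OF THE RE-BORN PART AT THE CORE LETTERS OF RECORD, ON THE TORUS — NO GEOMETRY HYPOTHESIS, OPERATOR LETTERS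
DISCHARGED** (kernel; S69 §2 `rebornMuDeriv_locE_le_of_coreLettersOf` ONCE BY NAME at `tsys 4 N` ∕ `tgeometry 4 N`, `b₅ := 5·r₁`,
`torus_consts` ∕ `K₀_four`). [folklore] -/
theorem rebornMuDeriv_locE_le_of_coreLettersOf_torus {W : Set (ℕ → ℝ)} {ctr : ℕ → (ℕ → ℝ) → D.carriers.BgB → Op × B13HistM P}
    {ROp RHist R' : ℕ → ℝ} (A : ∀ Z j, ActLetters D P Op 𝒵 dom Jc V mI Z j) {β₀ ϑ d₀ γ : D.carriers.Dom → J → ℝ}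
    (hroom : ∀ k, ROp k < R' k) (hR' : ∀ k, 0 ≤ R' k)
    (hbase : ∀ Z j ii jj, Measurable fun a => (A Z j).base a ii jj)
    (hrdm : ∀ Z j ii jj (o' : Op), Measurable fun a => (A Z j).rd a ii jj o')
    (hβ₀ : ∀ Z j, 0 ≤ β₀ Z j) (hd₀ : ∀ Z j, 0 < d₀ Z j)
    (hrd : ∀ Z j a ii jj, ‖(A Z j).rd a ii jj‖ ≤ ϑ Z j)
    (hctr : ∀ k, ∀ g ∈ W, ∀ (U : D.carriers.BgB) (Z : D.carriers.Dom) (j : J) (a : (Jc Z j ⊕ 𝒵 Z j) → ℝ × ℝ),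
      (∀ ii jj, ‖linForm (A Z j).base (A Z j).rd (ctr k g U).1 a ii jj‖ ≤ β₀ Z j) ∧
      ((linForm (A Z j).base (A Z j).rd (ctr k g U).1 a).det).im = 0 ∧ d₀ Z j ≤ ((linForm (A Z j).base (A Z j).rd (ctr k g U).1 a).det).re ∧
      (∀ x : mI Z j → ℂ, γ Z j * nsq x ≤ (star x ⬝ᵥ (linForm (A Z j).base (A Z j).rd (ctr k g U).1 a *ᵥ x)).re))
    (hbud : ∀ k Z j, detBudget (Fintype.card (mI Z j)) (β₀ Z j) (ϑ Z j) (R' k) < d₀ Z j)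
    (hmq : ∀ k Z j, Fintype.card (mI Z j) * ϑ Z j * R' k < γ Z j)
    {k : ℕ} {g : ℕ → ℝ} (hg : g ∈ W) {U : D.carriers.BgB} {o : Op} {h₀ u v : B13HistM P} {μ₁ ε : ℝ}
    (hv : 0 < ‖v‖) (hvε : ‖v‖ < ε)
    (hO : ‖o - (ctr k g U).1‖ ≤ ROp k) (hH : ‖h₀ - (ctr k g U).2‖ + μ₁ * ‖u‖ + ε ≤ RHist k)
    {emb : (tsys 4 N).Dom → D.carriers.Dom} (hscale : ∀ Z, D.carriers.scale (emb Z) = k)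
    (terms : (tsys 4 N).Dom → Finset (D.carriers.Dom × J))
    {A' R r₁ : ℝ} (X₀ : (tsys 4 N).Dom) (hA : 0 ≤ A') (hr₁ : 0 ≤ r₁)
    (hrate : r₁ + 2 * (64 * Real.log 162) + 2 ≤ R) (hsmall : A' * Real.exp (5 * r₁ + 1) * K₀ 64 8 * 9 * 64 ≤ 1)
    (hM3 : ∀ Z : (tsys 4 N).Dom, Z.1 ⊆ X₀.1 →
      ∑ p ∈ terms Z, (coreOf P Op 𝒵 dom Jc V (coreLettersOf D P Op 𝒵 dom Jc V mI A) p.1 p.2).lam.real univ *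
          ((coreOf P Op 𝒵 dom Jc V (coreLettersOf D P Op 𝒵 dom Jc V mI A) p.1 p.2).wB *
              (gaussC (mI p.1 p.2) * Real.sqrt (max 1 ((Fintype.card (mI p.1 p.2)).factorial *
                β₀ p.1 p.2 ^ Fintype.card (mI p.1 p.2) + d₀ p.1 p.2))) * Real.exp 0) *
          (Real.pi / ((γ p.1 p.2 - Fintype.card (mI p.1 p.2) * ϑ p.1 p.2 * R' k) / 2 / 2)) ^ (Module.finrank ℝ (V p.1 p.2) / 2 : ℝ) *
        Real.exp ((coreOf P Op 𝒵 dom Jc V (coreLettersOf D P Op 𝒵 dom Jc V mI A) p.1 p.2).N₁ * (‖h₀‖ + μ₁ * ‖u‖ + ε)) ≤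
        A' * Real.exp (-(R * torusTreeLen Z.1)))
    {μ₀ : ℝ} (h01 : μ₀ < μ₁) {μ : ℂ} (hμ : ‖μ‖ ≤ μ₀) :
    ‖deriv (fun m : ℂ =>
        locE (Dom := (tsys 4 N).Dom) (TTouch (d := 4) (N := N)) (fun Z : (tsys 4 N).Dom => Z.1) (fun Z => ∑ p ∈ terms Z,
            actOfLetters P Op 𝒵 dom Jc V (coreLettersOf D P Op 𝒵 dom Jc V mI A) p.1 p.2 o (h₀ + m • u + (1 : ℂ) • v))
            X₀.1 -
          locE (Dom := (tsys 4 N).Dom) (TTouch (d := 4) (N := N)) (fun Z : (tsys 4 N).Dom => Z.1) (fun Z => ∑ p ∈ terms Z,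
            actOfLetters P Op 𝒵 dom Jc V (coreLettersOf D P Op 𝒵 dom Jc V mI A) p.1 p.2 o (h₀ + m • u + (0 : ℂ) • v))
            X₀.1) μ‖ ≤
      2 * (2 * (Real.exp 1 * 9 * 64 * K₀ 64 8 ^ 2 * A' * Real.exp (-(r₁ * torusTreeLen X₀.1))) / ε * ‖v‖) / (μ₁ - μ₀) := by
  obtain ⟨hν, hκ, hc⟩ := torus_consts N
  have hK₀ := K₀_four (N := N)
  have h := rebornMuDeriv_locE_le_of_coreLettersOf D P Op 𝒵 dom Jc V mI (tsys 4 N) (tgeometry 4 N) A hroom hR' hbase hrdm hβ₀ hd₀ hrd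
    hctr hbud hmq hg hv hvε hO hH hscale terms (R := R) (b₅ := 5 * r₁) (X₀ := X₀) hA hr₁ (le_of_eq (by ring))
    (by rw [hκ]; exact hrate) (by rw [hK₀, hν, hc]; exact hsmall) hM3 h01 hμ
  rw [hν, hc, hK₀] at h
  exact h

end CoreLettersOf

end Summit.QuantumFields.BalabanUV.T4Continuum.NE1p.DressedRebornMuPartSlotLettersTorus

end
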